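import Mathlib
import Literature.NumberTheory.Sieve.PolynomialCongruencesProofs
import Literature.NumberTheory.Sieve.AletheiaZomleferFukshanskyGarcia2020Applications
import Literature.NumberTheory.Sieve.DivisorBound
import Literature.NumberTheory.Sieve.GoldbachSingularSeriesSum
import Summits.Parity.BatemanHorn.Theorems.AlmostPrimeZerosSystemMertensCounting
import HarnessLib

/-!
# Route `IsogenyRedei` — support item `SliceFrame` (stmt-Parity-14953): counting lemmas

The two error ranges of the squarefree sieve for `μ((n²+1)/e)` (step (i-b) of `SliceFrame`),
where the level `r` of the square divisor `r² ∣ n²+1` is too large for the parity input: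

* middle range — `#{n ≤ y : r² ∣ n²+1} ≤ C₂ √r ((y+1)/r² + 1)` for every `r ≥ 1`
  (`exists_card_sq_dvd_le`): the roots of `X²+1` modulo `r²` number
  `ρ(r²) ≤ C_ρ 2^{ω(r)}` (Hooley's Lemma 4, tree
  `Literature.NumberTheory.Sieve.exists_polyRootCountMod_le_mul_pow_card_primeFactors`) and
  `2^{ω(r)} ≤ τ(r) ≤ C_τ r^{1/2}` (tree
  `Literature.NumberTheory.Sieve.GoldbachSeries.two_pow_card_primeFactors_le_card_divisors` and the
  divisor bound `Literature.NumberTheory.Sieve.exists_card_divisors_le_mul_rpow`), each root class meeting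
  `[0, y]` in at most `(y+1)/r² + 1` integers (tree
  `Summit.Parity.BatemanHorn.Theorems.AlmostPrimeZeros.SystemMertens.card_filter_range_dvd_eval_le`);
  the resulting tail `∑_{r > R} r^{-3/2} ≤ 2/√R` is `sum_Ioc_one_div_mul_sqrt_le`;
* large range — `∑_{r ∈ T} #{n ≤ y : r² ∣ n²+1} ≤ ((y²+1)/Z²)(⌊log₃ y⌋ + 1)` when every
  `r ∈ T` exceeds `Z` (`sum_card_sq_dvd_large_le`): switch to the cofactor `s = (n²+1)/r² ≤
  (y²+1)/Z²` and count the solutions of the negative Pell equation `n² + 1 = s r²` for each `s`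
  — the Pell count is taken as the hypothesis `hPell`, which is literally `card_negPell_le` of
  `IsogenyRedeiSliceFramePell` (Estermann 1931); it is kept as a hypothesis only so that this file
  elaborates against Mathlib/Literature oleans alone (the frame file discharges it).
-/

namespace Summit.Parity.BatemanHorn.Theorems.SliceFrame

open Finset Polynomial
open Literature.NumberTheory.Sieve

/-! ### Middle range: root classes modulo `r²` -/

/-- `deg (X² + 1) = 2` over `ℤ`. [folklore] -/
theorem natDegree_X_sq_add_one : (X ^ 2 + 1 : ℤ[X]).natDegree = 2 := by
  simpa using natDegree_X_pow_add_C (n := 2) (r := (1 : ℤ))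

/-- **Middle-range count.** There is an absolute `C₂ > 0` with
`#{1 ≤ n ≤ y : r² ∣ n² + 1} ≤ C₂ √r ((y+1)/r² + 1)` for all `r ≥ 1` and all `y`
(`ρ(r²) ≤ C_ρ 2^{ω(r)} ≤ C_ρ τ(r) ≤ C_ρ C_τ √r` root classes, each with at most `(y+1)/r² + 1`
representatives in `[0, y]`). [folklore] -/
theorem exists_card_sq_dvd_le :
    ∃ C₂ : ℝ, 0 < C₂ ∧ ∀ r : ℕ, 1 ≤ r → ∀ y : ℕ,
      (((Finset.Icc 1 y).filter (fun n : ℕ => r ^ 2 ∣ n ^ 2 + 1)).card : ℝ)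
        ≤ C₂ * Real.sqrt r * (((y : ℝ) + 1) / (r : ℝ) ^ 2 + 1) := by
  classical
  obtain ⟨Cρ, hCρ1, hCρ⟩ := exists_polyRootCountMod_le_mul_pow_card_primeFactors
    irreducible_X_sq_add_one_int (by rw [natDegree_X_sq_add_one]; norm_num)
  obtain ⟨Cτ, hCτ1, hCτ⟩ := exists_card_divisors_le_mul_rpow (ε := 1 / 2) one_half_pos
  refine ⟨Cρ * Cτ, by positivity, fun r hr y => ?_⟩
  have hr0 : r ≠ 0 := by omega
  -- the count in `ℕ`, through the tree's progression count
  have h1 : ((Finset.Icc 1 y).filter (fun n : ℕ => r ^ 2 ∣ n ^ 2 + 1)).card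
      ≤ ((Finset.range (y + 1)).filter
          (fun n : ℕ => ((r ^ 2 : ℕ) : ℤ) ∣ (X ^ 2 + 1 : ℤ[X]).eval (n : ℤ))).card := by
    refine Finset.card_le_card (fun n hn => ?_)
    rw [Finset.mem_filter, Finset.mem_Icc] at hn
    rw [Finset.mem_filter, Finset.mem_range]
    refine ⟨by omega, ?_⟩
    have he : (X ^ 2 + 1 : ℤ[X]).eval (n : ℤ) = ((n ^ 2 + 1 : ℕ) : ℤ) := by
      simp only [eval_add, eval_pow, eval_X, eval_one]
      push_cast
      ring
    rw [he]
    exact Int.natCast_dvd_natCast.mpr hn.2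
  have h2 := AlmostPrimeZeros.SystemMertens.card_filter_range_dvd_eval_le (X ^ 2 + 1 : ℤ[X])
    (q := r ^ 2) (pow_pos (by omega) 2) (y + 1)
  have h3 : polyRootCountMod ![(X ^ 2 + 1 : ℤ[X])] (r ^ 2) ≤ Cρ * 2 ^ r.primeFactors.card := by
    have := hCρ (r ^ 2)
    rwa [natDegree_X_sq_add_one, Nat.primeFactors_pow r two_ne_zero] at this
  have h4 : (2 : ℝ) ^ r.primeFactors.card ≤ Cτ * Real.sqrt r := by
    have h := GoldbachSeries.two_pow_card_primeFactors_le_card_divisors hr0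
    have h' : ((r.divisors.card : ℕ) : ℝ) ≤ Cτ * (r : ℝ) ^ (1 / 2 : ℝ) := hCτ r hr0
    rw [← Real.sqrt_eq_rpow] at h'
    calc (2 : ℝ) ^ r.primeFactors.card = ((2 ^ r.primeFactors.card : ℕ) : ℝ) := by push_cast; ring
      _ ≤ (r.divisors.card : ℝ) := by exact_mod_cast h
      _ ≤ Cτ * Real.sqrt r := h'
  have h5 : ((((y + 1) / r ^ 2 : ℕ)) : ℝ) ≤ ((y : ℝ) + 1) / (r : ℝ) ^ 2 := by
    rw [le_div_iff₀ (by positivity)]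
    have := Nat.div_mul_le_self (y + 1) (r ^ 2)
    exact_mod_cast this
  have hCρ0 : (0 : ℝ) ≤ Cρ := by positivity
  calc (((Finset.Icc 1 y).filter (fun n : ℕ => r ^ 2 ∣ n ^ 2 + 1)).card : ℝ)
      ≤ ((polyRootCountMod ![(X ^ 2 + 1 : ℤ[X])] (r ^ 2) * ((y + 1) / r ^ 2 + 1) : ℕ) : ℝ) := by
        exact_mod_cast h1.trans h2
    _ = (polyRootCountMod ![(X ^ 2 + 1 : ℤ[X])] (r ^ 2) : ℝ) * ((((y + 1) / r ^ 2 : ℕ) : ℝ) + 1) := by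
        push_cast; ring
    _ ≤ ((Cρ : ℝ) * (2 : ℝ) ^ r.primeFactors.card) * (((y : ℝ) + 1) / (r : ℝ) ^ 2 + 1) := by
        refine mul_le_mul (by exact_mod_cast h3) (by linarith) (by positivity) (by positivity)
    _ ≤ ((Cρ : ℝ) * (Cτ * Real.sqrt r)) * (((y : ℝ) + 1) / (r : ℝ) ^ 2 + 1) := by
        gcongr
    _ = Cρ * Cτ * Real.sqrt r * (((y : ℝ) + 1) / (r : ℝ) ^ 2 + 1) := by ring

/-! ### The tail `∑_{r > R} r^{-3/2} ≤ 2/√R` -/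

/-- `1/((N+1)√(N+1)) ≤ 2(1/√N − 1/√(N+1))` for `N ≥ 1`. [folklore] -/
theorem one_div_mul_sqrt_succ_le {N : ℕ} (hN : 1 ≤ N) :
    1 / (((N : ℝ) + 1) * Real.sqrt ((N : ℝ) + 1))
      ≤ 2 * (1 / Real.sqrt N - 1 / Real.sqrt ((N : ℝ) + 1)) := by
  set a := Real.sqrt N with ha
  set b := Real.sqrt ((N : ℝ) + 1) with hb
  have hN0 : (0 : ℝ) < N := by exact_mod_cast hN
  have ha0 : 0 < a := Real.sqrt_pos.mpr hN0
  have hb0 : 0 < b := Real.sqrt_pos.mpr (by positivity)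
  have haa : a ^ 2 = N := Real.sq_sqrt hN0.le
  have hbb : b ^ 2 = (N : ℝ) + 1 := Real.sq_sqrt (by positivity)
  have hab : a ≤ b := Real.sqrt_le_sqrt (by linarith)
  have hdiff : b - a = 1 / (a + b) := by
    rw [eq_div_iff (by positivity)]
    nlinarith
  have hrhs : 2 * (1 / a - 1 / b) = 2 / ((a + b) * (a * b)) := by
    rw [div_sub_div _ _ ha0.ne' hb0.ne', one_mul, mul_one, hdiff]
    field_simp
  rw [← hbb, hrhs, div_le_div_iff₀ (by positivity) (by positivity)]
  nlinarith [mul_pos ha0 hb0, mul_le_mul_of_nonneg_left hab ha0.le]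

/-- **Tail of `∑ r^{-3/2}`.** For `1 ≤ R ≤ N`,
`∑_{R < r ≤ N} 1/(r√r) ≤ 2/√R − 2/√N`. [folklore] -/
theorem sum_Ioc_one_div_mul_sqrt_le_sub {R : ℕ} (hR : 1 ≤ R) {N : ℕ} (hRN : R ≤ N) :
    ∑ r ∈ Finset.Ioc R N, 1 / ((r : ℝ) * Real.sqrt r) ≤ 2 / Real.sqrt R - 2 / Real.sqrt N := by
  induction N, hRN using Nat.le_induction with
  | base => simp
  | succ N hRN ih =>
    rw [Finset.sum_Ioc_succ_top hRN]
    have h := one_div_mul_sqrt_succ_le (N := N) (le_trans hR hRN)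
    push_cast
    calc ∑ k ∈ Finset.Ioc R N, 1 / ((k : ℝ) * Real.sqrt k) + 1 / (((N : ℝ) + 1) * Real.sqrt ((N : ℝ) + 1))
        ≤ (2 / Real.sqrt R - 2 / Real.sqrt N) + 2 * (1 / Real.sqrt N - 1 / Real.sqrt ((N : ℝ) + 1)) :=
          add_le_add ih h
      _ = 2 / Real.sqrt R - 2 / Real.sqrt ((N : ℝ) + 1) := by ring

/-- **Tail of `∑ r^{-3/2}`**, crude form: `∑_{R < r ≤ N} 1/(r√r) ≤ 2/√R` for `R ≥ 1`.
[folklore] -/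
theorem sum_Ioc_one_div_mul_sqrt_le {R : ℕ} (hR : 1 ≤ R) (N : ℕ) :
    ∑ r ∈ Finset.Ioc R N, 1 / ((r : ℝ) * Real.sqrt r) ≤ 2 / Real.sqrt R := by
  rcases le_or_gt R N with h | h
  · have := sum_Ioc_one_div_mul_sqrt_le_sub hR h
    have h0 : 0 ≤ 2 / Real.sqrt N := by positivity
    linarith
  · rw [Finset.Ioc_eq_empty (by omega), Finset.sum_empty]
    positivity

/-! ### Large range: switch to the cofactor and count negative Pell solutions -/

open Classical in
/-- **Large-range count.** If every `r ∈ T` exceeds `Z > 0`, then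
`∑_{r ∈ T} #{1 ≤ n ≤ y : r² ∣ n²+1} ≤ ((y²+1)/Z²)·(⌊log₃ y⌋ + 1)`: the cofactor
`s = (n²+1)/r²` is at most `(y²+1)/Z²`, determines `r`, and for each `s` the negative Pell
equation `n² + 1 = s r²` has at most `⌊log₃ y⌋ + 1` solutions `n ≤ y` (hypothesis `hPell` =
`card_negPell_le`, Estermann 1931). [folklore] -/
theorem sum_card_sq_dvd_large_le
    (hPell : ∀ D y : ℕ, ((Finset.Icc 1 y).filter
      (fun n : ℕ => ∃ r : ℕ, n ^ 2 + 1 = D * r ^ 2)).card ≤ Nat.log 3 y + 1)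
    (y : ℕ) {Z : ℝ} (hZ : 0 < Z) (T : Finset ℕ) (hT : ∀ r ∈ T, Z < (r : ℝ)) :
    ∑ r ∈ T, (((Finset.Icc 1 y).filter (fun n : ℕ => r ^ 2 ∣ n ^ 2 + 1)).card : ℝ)
      ≤ ((y : ℝ) ^ 2 + 1) / Z ^ 2 * (Nat.log 3 y + 1) := by
  set S : ℕ := ⌊((y : ℝ) ^ 2 + 1) / Z ^ 2⌋₊ with hS
  have hS0 : (0 : ℝ) ≤ ((y : ℝ) ^ 2 + 1) / Z ^ 2 := by positivity
  -- exchange the order of summation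
  have hswap := AlmostPrimeZeros.SystemMertens.sum_card_filter_comm T (Finset.Icc 1 y)
    (fun r n => r ^ 2 ∣ n ^ 2 + 1)
  -- for each `n`, inject `r ↦ (n²+1)/r²` into `[1, S]`
  have hinner : ∀ n ∈ Finset.Icc 1 y,
      (T.filter (fun r : ℕ => r ^ 2 ∣ n ^ 2 + 1)).card
        ≤ ((Finset.Icc 1 S).filter (fun s : ℕ => ∃ r : ℕ, n ^ 2 + 1 = s * r ^ 2)).card := by
    intro n hn
    have hny : n ≤ y := (Finset.mem_Icc.mp hn).2
    refine Finset.card_le_card_of_injOn (fun r => (n ^ 2 + 1) / r ^ 2) (fun r hr => ?_)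
      (fun r hr r' hr' h => ?_)
    · rw [Finset.coe_filter, Set.mem_setOf_eq] at hr
      obtain ⟨hrT, hdvd⟩ := hr
      have hZr := hT r hrT
      have hr0 : (0 : ℝ) < r := hZ.trans hZr
      have hr0' : 0 < r := by exact_mod_cast hr0
      rw [Finset.coe_filter, Set.mem_setOf_eq, Finset.mem_Icc]
      refine ⟨⟨?_, ?_⟩, r, (Nat.div_mul_cancel hdvd).symm⟩
      · exact Nat.div_pos (Nat.le_of_dvd (Nat.succ_pos _) hdvd) (pow_pos hr0' 2)
      · refine Nat.le_floor ?_
        have hle : ((((n ^ 2 + 1) / r ^ 2 : ℕ)) : ℝ) ≤ ((n ^ 2 + 1 : ℕ) : ℝ) / ((r ^ 2 : ℕ) : ℝ) :=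
          Nat.cast_div_le
        refine hle.trans ?_
        have hr2 : Z ^ 2 ≤ ((r ^ 2 : ℕ) : ℝ) := by
          push_cast
          nlinarith
        have hn2 : ((n ^ 2 + 1 : ℕ) : ℝ) ≤ (y : ℝ) ^ 2 + 1 := by
          have : (n : ℝ) ≤ y := by exact_mod_cast hny
          push_cast
          nlinarith
        calc ((n ^ 2 + 1 : ℕ) : ℝ) / ((r ^ 2 : ℕ) : ℝ)
            ≤ ((y : ℝ) ^ 2 + 1) / ((r ^ 2 : ℕ) : ℝ) :=
              div_le_div_of_nonneg_right hn2 (by positivity)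
          _ ≤ ((y : ℝ) ^ 2 + 1) / Z ^ 2 :=
              div_le_div_of_nonneg_left (by positivity) (by positivity) hr2
    · rw [Finset.coe_filter, Set.mem_setOf_eq] at hr hr'
      obtain ⟨hrT, hdvd⟩ := hr
      obtain ⟨hr'T, hdvd'⟩ := hr'
      simp only at h
      have hr0 : 0 < r := by exact_mod_cast hZ.trans (hT r hrT)
      have hr'0 : 0 < r' := by exact_mod_cast hZ.trans (hT r' hr'T)
      have hs0 : 0 < (n ^ 2 + 1) / r ^ 2 :=
        Nat.div_pos (Nat.le_of_dvd (Nat.succ_pos _) hdvd) (pow_pos hr0 2)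
      have e1 := Nat.div_mul_cancel hdvd
      have e2 := Nat.div_mul_cancel hdvd'
      rw [h] at e1
      have hsq : r ^ 2 = r' ^ 2 := by
        have : (n ^ 2 + 1) / r' ^ 2 * r ^ 2 = (n ^ 2 + 1) / r' ^ 2 * r' ^ 2 := e1.trans e2.symm
        rw [h] at hs0
        exact Nat.eq_of_mul_eq_mul_left hs0 this
      exact Nat.pow_left_injective two_ne_zero hsq
  -- exchange again and apply the Pell count
  have hswap2 := AlmostPrimeZeros.SystemMertens.sum_card_filter_comm (Finset.Icc 1 y)
    (Finset.Icc 1 S) (fun n s => ∃ r : ℕ, n ^ 2 + 1 = s * r ^ 2)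
  have hpell : ∀ s ∈ Finset.Icc 1 S,
      ((Finset.Icc 1 y).filter (fun n : ℕ => ∃ r : ℕ, n ^ 2 + 1 = s * r ^ 2)).card
        ≤ Nat.log 3 y + 1 := fun s _ => hPell s y
  have hnat : ∑ r ∈ T, ((Finset.Icc 1 y).filter (fun n : ℕ => r ^ 2 ∣ n ^ 2 + 1)).card
      ≤ S * (Nat.log 3 y + 1) := by
    calc ∑ r ∈ T, ((Finset.Icc 1 y).filter (fun n : ℕ => r ^ 2 ∣ n ^ 2 + 1)).card
        = ∑ n ∈ Finset.Icc 1 y, (T.filter (fun r : ℕ => r ^ 2 ∣ n ^ 2 + 1)).card := hswap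
      _ ≤ ∑ n ∈ Finset.Icc 1 y,
            ((Finset.Icc 1 S).filter (fun s : ℕ => ∃ r : ℕ, n ^ 2 + 1 = s * r ^ 2)).card :=
          Finset.sum_le_sum hinner
      _ = ∑ s ∈ Finset.Icc 1 S,
            ((Finset.Icc 1 y).filter (fun n : ℕ => ∃ r : ℕ, n ^ 2 + 1 = s * r ^ 2)).card := hswap2
      _ ≤ ∑ _s ∈ Finset.Icc 1 S, (Nat.log 3 y + 1) := Finset.sum_le_sum hpell
      _ = S * (Nat.log 3 y + 1) := by rw [Finset.sum_const, Nat.card_Icc, smul_eq_mul]; simp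
  have hSle : (S : ℝ) ≤ ((y : ℝ) ^ 2 + 1) / Z ^ 2 := Nat.floor_le hS0
  calc ∑ r ∈ T, (((Finset.Icc 1 y).filter (fun n : ℕ => r ^ 2 ∣ n ^ 2 + 1)).card : ℝ)
      ≤ ((S * (Nat.log 3 y + 1) : ℕ) : ℝ) := by exact_mod_cast hnat
    _ = (S : ℝ) * (Nat.log 3 y + 1) := by push_cast; ring
    _ ≤ ((y : ℝ) ^ 2 + 1) / Z ^ 2 * (Nat.log 3 y + 1) :=
        mul_le_mul_of_nonneg_right hSle (by positivity)

end Summit.Parity.BatemanHorn.Theorems.SliceFrame
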